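/- Copyright: the b2b-balaban cell (near-miss cell 7), T⁴-continuum fan-out, row NE7b owner lineage
`b2b-balaban-t4-ne7b-p1` (gen 23), node U5c COUNT member.  Released under the licence of the surrounding project. -/
import Literature.MathematicalPhysics.QuantumFieldTheory.Balaban1983to89.T4MatchingAssembly

/-!
# The hybrid-NE7 datum is invariant under positive per-cutoff rescaling of each run (normalisation change)

Summits-side support leaf of the T⁴-continuum cell (rung (B)+1 on a FINITE torus only; NOT infinite volume, NOT the
mass gap, NOT the Clay statement; NOT a proof of the spine estimate NE7b).  Row S12 ∕ node A12-I of the claim table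
`t4/b2b-balaban-t4-ne7b-p1/LEAVES-NE7b.md` (owner sub-row S12g «APEX», file 1 of 2).

WHAT.  The seam's output `T4MatchingAssembly.HybridNE7 l₀ vol T A B Bad W shA shB Wsh δ` compares the two runs' term
families only through RELATIVE statements (`RelWeightBound`, `ShellWeightBound`) and a sandwich MODULO A FREE CONSTANT per
cutoff (`core : ∀ K, ∃ c, …`).  Hence it is invariant under `A K t τ ↦ z K · A K t τ`, `shA ↦ z · shA` and
`B ↦ z′ · B`, `shB ↦ z′ · shB` for any POSITIVE `z K`, `z′ K` (`relWeightBound_smul`, `shellWeightBound_smul`,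
`hybridNE7_smul`).  WHY: the count road's END (`HistoryRealiseCellsRunEnd` ∕ `…Pinned`) reads its term families in
BAŁABAN's normalisation `Σ_T A = ∫ e^{t·obs} ρ₀ dU` (`ρ₀ = c·e^{−A∕g₀²}`, `T4Continuum.Realisation.rho_zero`), while the
apex's per-string input `T4MatchingAssembly.StringHybridNE7` wants the Wilson normalisation
`Σ_T A = T4GenFunBounds.schemeZ` — the two differ by the run's constant `c_K > 0`
(`T4StabilitySocket.exists_const_dressedZ`); file 2 (`HistoryRealiseCellsRunApex`) rescales by `c_K⁻¹`.
[folklore] elementary; no `def`, no `[cite:]` tag, nothing printed asserted.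

HONEST.  NE7b NOT proved; spine 0∕9.  HONEST DEPENDENCY (cell): continuum YM on T⁴ ⇐ BetaPertH ∧ nine spine estimates
(0/9 proved); BetaPertH ⇐ (D1) ∧ (D4) ∧ CAP+tail; G-an2-4 gates asym, D1 and NE2/3/4.  This file changes none of it. -/

open Finset
open Literature.MathematicalPhysics.QuantumFieldTheory.Balaban1983to89
open T4WeightBudget T4IndicatorShell T4MatchingAssembly

namespace Summit.QuantumFields.BalabanUV.T4Continuum.HistoryHybridRescale

section Smul

variable {ι : Type*} {l₀ vol : ℝ} {T : ℕ → Finset ι} {A B shA shB : ℕ → ℝ → ι → ℝ} {Bad : ℕ → ℝ → Finset ι}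
  {W Wsh δ : ℕ → ℝ} {z z' : ℕ → ℝ}

/-- A relative bound `Σ_S f ≤ w · Σ_T g` survives multiplication of `f` and `g` by the same nonnegative constant.
[folklore] -/
theorem sum_mul_le_of_sum_le {S T' : Finset ι} {f g : ι → ℝ} {w c : ℝ} (hc : 0 ≤ c)
    (h : ∑ τ ∈ S, f τ ≤ w * ∑ τ ∈ T', g τ) :
    ∑ τ ∈ S, c * f τ ≤ w * ∑ τ ∈ T', c * g τ := by
  rw [← mul_sum, ← mul_sum, mul_left_comm]
  exact mul_le_mul_of_nonneg_left h hc

/-- **`RelWeightBound` is invariant under nonnegative per-cutoff rescaling of each run** (it is a RELATIVE bound, run by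
run). [folklore] -/
theorem relWeightBound_smul (hz : ∀ K, 0 ≤ z K) (hz' : ∀ K, 0 ≤ z' K) (h : RelWeightBound l₀ T A B Bad W) :
    RelWeightBound l₀ T (fun K t τ => z K * A K t τ) (fun K t τ => z' K * B K t τ) Bad W where
  bad_subset := h.bad_subset
  nonneg := h.nonneg
  lt_one := h.lt_one
  summable := h.summable
  bad_left K t ht := sum_mul_le_of_sum_le (hz K) (h.bad_left K t ht)
  bad_right K t ht := sum_mul_le_of_sum_le (hz' K) (h.bad_right K t ht)

/-- **`ShellWeightBound` is invariant under nonnegative per-cutoff rescaling of each run, shells rescaled alike.**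
[folklore] -/
theorem shellWeightBound_smul (hz : ∀ K, 0 ≤ z K) (hz' : ∀ K, 0 ≤ z' K) (h : ShellWeightBound l₀ T A B shA shB Wsh) :
    ShellWeightBound l₀ T (fun K t τ => z K * A K t τ) (fun K t τ => z' K * B K t τ) (fun K t τ => z K * shA K t τ)
      (fun K t τ => z' K * shB K t τ) Wsh where
  nonneg := h.nonneg
  summable := h.summable
  sh_nonneg_left K t ht τ hτ := mul_nonneg (hz K) (h.sh_nonneg_left K t ht τ hτ)
  sh_le_left K t ht τ hτ := mul_le_mul_of_nonneg_left (h.sh_le_left K t ht τ hτ) (hz K)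
  sh_nonneg_right K t ht τ hτ := mul_nonneg (hz' K) (h.sh_nonneg_right K t ht τ hτ)
  sh_le_right K t ht τ hτ := mul_le_mul_of_nonneg_left (h.sh_le_right K t ht τ hτ) (hz' K)
  left K t ht := sum_mul_le_of_sum_le (hz K) (h.left K t ht)
  right K t ht := sum_mul_le_of_sum_le (hz' K) (h.right K t ht)

/-- **THE HYBRID-NE7 DATUM IS INVARIANT UNDER POSITIVE PER-CUTOFF RESCALING OF EACH RUN** (terms and shells of run A by
`z K > 0`, of run B by `z′ K > 0`): the weight and shell clauses are relative, the budgets `W`, `Wsh`, `δ` are unchanged,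
and the core sandwich's free constant moves by `log (z′ K ∕ z K)`. [folklore] -/
theorem hybridNE7_smul [DecidableEq ι] (hz : ∀ K, 0 < z K) (hz' : ∀ K, 0 < z' K)
    (h : HybridNE7 l₀ vol T A B Bad W shA shB Wsh δ) :
    HybridNE7 l₀ vol T (fun K t τ => z K * A K t τ) (fun K t τ => z' K * B K t τ) Bad W
      (fun K t τ => z K * shA K t τ) (fun K t τ => z' K * shB K t τ) Wsh δ where
  weight := relWeightBound_smul (fun K => (hz K).le) (fun K => (hz' K).le) h.weight
  shell := shellWeightBound_smul (fun K => (hz K).le) (fun K => (hz' K).le) h.shell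
  lt_one := h.lt_one
  summable := h.summable
  core K := by
    obtain ⟨c, hc⟩ := h.core K
    refine ⟨c + Real.log (z' K / z K), fun t ht τ hτ => ?_⟩
    obtain ⟨hlo, hhi⟩ := hc t ht τ hτ
    have hzK := hz K
    have hz'K := hz' K
    have hexp : ∀ x : ℝ, Real.exp (c + Real.log (z' K / z K) + x) = (z' K / z K) * Real.exp (c + x) := by
      intro x
      rw [show c + Real.log (z' K / z K) + x = Real.log (z' K / z K) + (c + x) by ring, Real.exp_add,
        Real.exp_log (div_pos hz'K hzK)]
    have hsub : ∀ x : ℝ, Real.exp (c + Real.log (z' K / z K) - x) = (z' K / z K) * Real.exp (c - x) := by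
      intro x
      rw [sub_eq_add_neg, hexp, ← sub_eq_add_neg]
    constructor
    · rw [hsub, ← mul_sub, show z' K / z K * Real.exp (c - vol * δ K) * (z K * (A K t τ - shA K t τ)) =
          z' K * (Real.exp (c - vol * δ K) * (A K t τ - shA K t τ)) by field_simp, ← mul_sub]
      exact mul_le_mul_of_nonneg_left hlo hz'K.le
    · rw [hexp, ← mul_sub, ← mul_sub, show z' K / z K * Real.exp (c + vol * δ K) * (z K * (A K t τ - shA K t τ)) =
          z' K * (Real.exp (c + vol * δ K) * (A K t τ - shA K t τ)) by field_simp]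
      exact mul_le_mul_of_nonneg_left hhi hz'K.le

end Smul

end Summit.QuantumFields.BalabanUV.T4Continuum.HistoryHybridRescale
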